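/-
Copyright (c) 2026. All rights reserved.
Released under Apache 2.0 license as described in the file LICENSE.
Authors: abc-iut cell, fact-proving seat abc-iut-f-074 (block F, tranche 74; FACT-LIST rows F-0326,
F-0330, F-0331, F-0333 of abc-iut-L4-t9's `BiAnabelianTelecore.lean`, exact criterion).
-/
import Literature.AnabelianGeometry.AbsoluteAnabelian.AbsTopIII.BiAnabelianDeltaFamilyProofs
import Literature.AnabelianGeometry.AbsoluteAnabelian.AbsTopIII.MonoAnabelianComparisonShapesPaths

/-!
# [AbsTopIII] Cor 3.7 (ii)–(iv): the shadow of `𝒟*` — λ-types of paths and the `ι_×`-cells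

S. Mochizuki, *Topics in absolute anabelian geometry III* [MochizukiAbsTopIII2015] (kurims manuscript
`paper:url-5493eb38cbb7`), Cor 3.7 (ii)–(iv) pp. 87–88; Def 3.5 (i)–(ii) pp. 74–75.

PROOF-ONLY companion (technical) of `BiAnabelianTelecore.lean` (abc-iut-L4-t9).  Seat abc-iut-L4-t12's
pseudo-commuting shadow `deltaShadow θ` of the diagram `𝒟*` (`BiAnabelianDeltaFamilyProofs.lean`:
shadows `𝒳` on rows ≤ 2 and the core with identity edge functors, `𝒩` with `λ^×`, `λ^{×pf}`, `𝔈`)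
carries, besides the "equal shadows" relation used for `ℋ_δ`, ONE non-invertible 2-cell: `ι_× :
λ^× ⟶ λ^{×pf}`.  This file prepares the coherent system of shadow 2-cells generated by it (assembled in
`BiAnabelianStarLaxCells.lean`, consumed by the exact criterion for Cor 3.7 (iv)):

* (combinatorics of `Γ⃗_{𝒟*}` — rows, the λ-TYPE `starLamType` of a path, the FLIP `starFlip` — is in
  `MonoAnabelianComparisonShapesPaths.lean`;)
* shadows: two co-verticial paths with the same λ-type have EQUAL shadows (`shP_eq_of_starLamType_eq`;
  on rows ≤ 2 and the core every shadow is `𝟭_𝒳`, `shP_heq_id`);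
* the `ι_×`-cell of a path, `iotaP θ p : sh_[γ] ⟶ sh_[flip γ]` (structural recursion: `ι_×` inserted at
  the `λ^×`-edge, identities elsewhere), its triviality on `λ^×`-free paths (`iotaP_eq_eqToHom`), its
  behaviour under composition of paths (`iotaP_comp_app`); its independence of the path within a
  λ-type is in `BiAnabelianStarLaxCells.lean`.

Refereed pre-IUT anabelian geometry, pure bookkeeping; nothing here bears on [IUTchIII] Cor. 3.12.
-/

set_option autoImplicit false

namespace Literature.AnabelianGeometry.AbsoluteAnabelian

open CategoryTheory Quiver DiagramOfCategories

universe w u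

namespace AbsTopIII

/-! ## The shadow of `𝒟*`: normal forms -/

namespace BiAnabelianSetting

variable {X E N : Type u} [Category.{u} X] [Category.{u} E] [Category.{u} N]
  (𝔖 : BiAnabelianSetting X E N) (θ : FiberSquare.BiAnabelianLift 𝔖.gal)

/-- On rows `≤ 2` and the core every shadow of `𝒟*` is the identity of `𝒳` (heterogeneously: the shadow
categories there are `𝒳` by abc-iut-L4-t12's `deltaSh`). [cite: MochizukiAbsTopIII2015, Cor 3.7 (ii) p.87] -/
theorem shP_heq_id {a b : Cor37Vertex} (p : StarPath.{u} a b) (hb : b.row ≤ 2) :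
    (𝔖.deltaShadow θ).shP p ≍ 𝟭 X := by
  have hsrc : ∀ {a b : Cor37Vertex} (p : StarPath.{u} a b), b.row ≤ 2 → 3 ≤ a.row → False :=
    fun p hb ha => absurd (ha.trans ((Cor37Vertex.row_le_of_path p).trans hb)) (by omega)
  cases a with
  | space => exact (hsrc p hb (by simp [Cor37Vertex.row])).elim
  | galois => exact (hsrc p hb (by simp [Cor37Vertex.row])).elim
  | first n =>
    induction p with
    | nil => exact HEq.rfl
    | cons p e ih =>
      cases e <;> simp only [Cor37Vertex.row] at hb <;> (try omega) <;>
        (apply heq_of_eq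
         rw [PseudoShadow.shP_cons, eq_of_heq (ih (by simp [Cor37Vertex.row]))]
         rfl)
  | box =>
    induction p with
    | nil => exact HEq.rfl
    | cons p e ih =>
      cases e <;> simp only [Cor37Vertex.row] at hb <;> (try omega) <;>
        (apply heq_of_eq
         rw [PseudoShadow.shP_cons, eq_of_heq (ih (by simp [Cor37Vertex.row]))]
         rfl)
  | ref =>
    induction p with
    | nil => exact HEq.rfl
    | cons p e ih =>
      cases e <;> simp only [Cor37Vertex.row] at hb <;> (try omega) <;>
        (apply heq_of_eq
         rw [PseudoShadow.shP_cons, eq_of_heq (ih (by simp [Cor37Vertex.row]))]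
         rfl)

/-- Co-verticial paths into a vertex of rows `≤ 2` / the core have EQUAL shadows.
[cite: MochizukiAbsTopIII2015, Cor 3.7 (ii) p.87] -/
theorem shP_eq_of_row {a b : Cor37Vertex} (p q : StarPath.{u} a b) (hb : b.row ≤ 2) :
    (𝔖.deltaShadow θ).shP p = (𝔖.deltaShadow θ).shP q :=
  eq_of_heq ((𝔖.shP_heq_id θ p hb).trans (𝔖.shP_heq_id θ q hb).symm)

/-- Paths from the vertex `𝒩` to itself are trivial. [cite: MochizukiAbsTopIII2015, Cor 3.7 (ii) p.87] -/
theorem starPath_space_space_eq_nil (p : StarPath.{w} .space .space) : p = Path.nil := by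
  cases p with
  | nil => rfl
  | cons p e =>
    cases e <;> exact absurd (Cor37Vertex.row_le_of_path p) (by simp [Cor37Vertex.row])

/-- Paths from the vertex `𝔈` to itself are trivial. [cite: MochizukiAbsTopIII2015, Cor 3.7 (ii) p.87] -/
theorem starPath_galois_galois_eq_nil (p : StarPath.{w} .galois .galois) : p = Path.nil := by
  cases p with
  | nil => rfl
  | cons p e =>
    cases e; exact absurd (Cor37Vertex.row_le_of_path p) (by simp [Cor37Vertex.row])

/-- Co-verticial paths into `𝒩` with the same λ-type have equal shadows.
[cite: MochizukiAbsTopIII2015, Cor 3.7 (iii) p.88] -/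
theorem shP_eq_space {a : Cor37Vertex} (p q : StarPath.{u} a .space)
    (h : starLamType p = starLamType q) :
    (𝔖.deltaShadow θ).shP p = (𝔖.deltaShadow θ).shP q := by
  cases p with
  | nil => rw [starPath_space_space_eq_nil q]
  | cons p e =>
    cases e with
    | lamTimes =>
      cases q with
      | nil => exact absurd (Cor37Vertex.row_le_of_path p) (by simp [Cor37Vertex.row])
      | cons q e' =>
        cases e' with
        | lamTimes =>
          rw [PseudoShadow.shP_cons, PseudoShadow.shP_cons, 𝔖.shP_eq_of_row θ p q (by simp [Cor37Vertex.row])]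
        | lamTimesPf => exact absurd h (by simp [starLamType, Cor37Edge.lamType])
    | lamTimesPf =>
      cases q with
      | nil => exact absurd (Cor37Vertex.row_le_of_path p) (by simp [Cor37Vertex.row])
      | cons q e' =>
        cases e' with
        | lamTimes => exact absurd h (by simp [starLamType, Cor37Edge.lamType])
        | lamTimesPf =>
          rw [PseudoShadow.shP_cons, PseudoShadow.shP_cons, 𝔖.shP_eq_of_row θ p q (by simp [Cor37Vertex.row])]

/-- **Co-verticial paths on `Γ⃗_{𝒟*}` with the same λ-type have equal shadows.**
[cite: MochizukiAbsTopIII2015, Cor 3.7 (iii) p.88] -/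
theorem shP_eq_of_starLamType_eq {a b : Cor37Vertex} (p q : StarPath.{u} a b)
    (h : starLamType p = starLamType q) :
    (𝔖.deltaShadow θ).shP p = (𝔖.deltaShadow θ).shP q := by
  cases b with
  | first n => exact 𝔖.shP_eq_of_row θ p q (by simp [Cor37Vertex.row])
  | box => exact 𝔖.shP_eq_of_row θ p q (by simp [Cor37Vertex.row])
  | ref => exact 𝔖.shP_eq_of_row θ p q (by simp [Cor37Vertex.row])
  | space => exact 𝔖.shP_eq_space θ p q h
  | galois =>
    cases p with
    | nil => rw [starPath_galois_galois_eq_nil q]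
    | cons p e =>
      cases e
      cases q with
      | nil => exact absurd (Cor37Vertex.row_le_of_path p) (by simp [Cor37Vertex.row])
      | cons q e' =>
        cases e'
        simp only [starLamType, Cor37Edge.lamType, Option.none_or] at h
        rw [PseudoShadow.shP_cons, PseudoShadow.shP_cons, 𝔖.shP_eq_space θ p q h]

/-! ## The `ι_×`-cells of the shadow of `𝒟*` -/

/-- Components of a natural transformation at propositionally equal objects agree heterogeneously.
[folklore] -/
private theorem app_heq {C D : Type u} [Category.{u} C] [Category.{u} D] {F G : C ⥤ D} (α : F ⟶ G)
    {x y : C} (h : x = y) : α.app x ≍ α.app y := by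
  subst h; rfl

/-- A functor preserves heterogeneous equality of morphisms with equal endpoints. [folklore] -/
private theorem map_heq {C D : Type u} [Category.{u} C] [Category.{u} D] (F : C ⥤ D) {x y x' y' : C}
    (hx : x = x') (hy : y = y') {f : x ⟶ y} {g : x' ⟶ y'} (h : f ≍ g) : F.map f ≍ F.map g := by
  subst hx hy; cases h; rfl

/-- Whiskering an `eqToHom` on the right gives an `eqToHom`. [folklore] -/
private theorem whiskerRight_eqToHom' {A B C : Type u} [Category.{u} A] [Category.{u} B]
    [Category.{u} C] {F G : A ⥤ B} (h : F = G) (H : B ⥤ C) :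
    Functor.whiskerRight (eqToHom h) H = eqToHom (by rw [h]) := by
  subst h; simp

/-- Whiskering an `eqToHom` on the left gives an `eqToHom`. [folklore] -/
private theorem whiskerLeft_eqToHom' {A B C : Type u} [Category.{u} A] [Category.{u} B]
    [Category.{u} C] (F : A ⥤ B) {G H : B ⥤ C} (h : G = H) :
    Functor.whiskerLeft F (eqToHom h) = eqToHom (by rw [h]) := by
  subst h; simp

/-- The 2-cell of an edge of `Γ⃗_{𝒟*}` towards its flip, on the shadow: `ι_× : λ^× ⟶ λ^{×pf}` on the edge
`λ^×`, the identity on every other edge. [cite: MochizukiAbsTopIII2015, Cor 3.7 (iii) p.88] -/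
def iotaE : ∀ {a b : Cor37Vertex} (e : Cor37Edge.{u} a b), (𝔖.deltaShe e ⟶ 𝔖.deltaShe (Cor37Edge.flip e))
  | _, _, .log _ _ _ => 𝟙 _
  | _, _, .pr _ => 𝟙 _
  | _, _, .lamTimes => 𝔖.iotaTimes
  | _, _, .lamTimesPf => 𝟙 _
  | _, _, .toGal => 𝟙 _
  | _, _, .proj _ => 𝟙 _
  | _, _, .diag _ => 𝟙 _
  | _, _, .diagBox => 𝟙 _

/-- On an edge other than `λ^×` the 2-cell `iotaE` is trivial. [cite: MochizukiAbsTopIII2015, Cor 3.7 (iii) p.88] -/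
theorem iotaE_eq_eqToHom {a b : Cor37Vertex} (e : Cor37Edge.{u} a b) (he : e.lamType ≠ some true) :
    𝔖.iotaE e = eqToHom (by rw [Cor37Edge.flip_eq_self e he]) := by
  cases e <;> first | exact absurd rfl he | exact (eqToHom_refl _ _).symm

/-- **The `ι_×`-cell of a path** on the shadow of `𝒟*`: the 2-cell `sh_[γ] ⟶ sh_[flip γ]` inserting `ι_×`
at the `λ^×`-edge of `γ` (identities elsewhere), by structural recursion on `γ`.
[cite: MochizukiAbsTopIII2015, Cor 3.7 (iii) p.88] -/
def iotaP {a : Cor37Vertex} : ∀ {b : Cor37Vertex} (p : StarPath.{u} a b),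
    ((𝔖.deltaShadow θ).shP p ⟶ (𝔖.deltaShadow θ).shP (starFlip p))
  | _, .nil => 𝟙 _
  | _, .cons p e => Functor.whiskerRight (iotaP p) ((𝔖.deltaShadow θ).she e) ≫
      Functor.whiskerLeft ((𝔖.deltaShadow θ).shP (starFlip p)) (𝔖.iotaE e)

/-- `iotaP` of the empty path. [cite: MochizukiAbsTopIII2015, Cor 3.7 (iii) p.88] -/
@[simp] theorem iotaP_nil (a : Cor37Vertex) : 𝔖.iotaP θ (Path.nil : StarPath.{u} a a) = 𝟙 _ := rfl

/-- Components of `iotaP` of an extended path. [cite: MochizukiAbsTopIII2015, Cor 3.7 (iii) p.88] -/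
theorem iotaP_cons_app {a b c : Cor37Vertex} (p : StarPath.{u} a b) (e : Cor37Edge.{u} b c)
    (y : (𝔖.deltaShadow θ).Sh a) :
    (𝔖.iotaP θ (p.cons e)).app y = ((𝔖.deltaShadow θ).she e).map ((𝔖.iotaP θ p).app y) ≫
      (𝔖.iotaE e).app (((𝔖.deltaShadow θ).shP (starFlip p)).obj y) := rfl

/-- On a path not through `λ^×` the `ι_×`-cell is trivial. [cite: MochizukiAbsTopIII2015, Cor 3.7 (iii) p.88] -/
theorem iotaP_eq_eqToHom {a b : Cor37Vertex} (p : StarPath.{u} a b) (h : starLamType p ≠ some true) :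
    𝔖.iotaP θ p = eqToHom (by rw [starFlip_eq_self p h]) := by
  induction p with
  | nil => exact (eqToHom_refl _ _).symm
  | cons p e ih =>
    have he : Cor37Edge.lamType e ≠ some true := fun he => h (by simp [starLamType, he])
    have hp : starLamType p ≠ some true := by
      intro hp
      cases e
      case lamTimes => exact he rfl
      case lamTimesPf =>
        exact absurd (starLamType_eq_none_of_row p (by simp [Cor37Vertex.row])) (by simp [hp])
      all_goals exact h (by simp [starLamType, Cor37Edge.lamType, hp])
    change Functor.whiskerRight (𝔖.iotaP θ p) _ ≫ Functor.whiskerLeft _ (𝔖.iotaE e) = _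
    rw [ih hp, 𝔖.iotaE_eq_eqToHom e he]
    refine NatTrans.ext (funext fun y => ?_)
    simp only [NatTrans.comp_app, Functor.whiskerRight_app, Functor.whiskerLeft_app, eqToHom_app,
      eqToHom_map]
    exact eqToHom_trans _ _

/-- **Composition law** for the `ι_×`-cells (heterogeneous form): `ι_{γ₂∘γ₁} = sh_[γ₂](ι_{γ₁}) ≫ ι_{γ₂}`.
[cite: MochizukiAbsTopIII2015, Cor 3.7 (iii) p.88] -/
theorem iotaP_comp_app_heq {c a : Cor37Vertex} (r : StarPath.{u} c a) :
    ∀ {b : Cor37Vertex} (p : StarPath.{u} a b) (y : (𝔖.deltaShadow θ).Sh c),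
      (𝔖.iotaP θ (r.comp p)).app y ≍
        ((𝔖.deltaShadow θ).shP p).map ((𝔖.iotaP θ r).app y) ≫
          (𝔖.iotaP θ p).app (((𝔖.deltaShadow θ).shP (starFlip r)).obj y)
  | _, .nil, y => by
    change (𝔖.iotaP θ r).app y ≍ (𝔖.iotaP θ r).app y ≫ 𝟙 _
    rw [Category.comp_id]
  | _, .cons p e, y => by
    have hs : ((𝔖.deltaShadow θ).shP (r.comp p)).obj y =
        ((𝔖.deltaShadow θ).shP p).obj (((𝔖.deltaShadow θ).shP r).obj y) :=
      (𝔖.deltaShadow θ).shP_comp_obj r p y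
    have ht : ((𝔖.deltaShadow θ).shP (starFlip (r.comp p))).obj y =
        ((𝔖.deltaShadow θ).shP (starFlip p)).obj (((𝔖.deltaShadow θ).shP (starFlip r)).obj y) := by
      rw [starFlip_comp]; exact (𝔖.deltaShadow θ).shP_comp_obj _ _ y
    have key := map_heq ((𝔖.deltaShadow θ).she e) hs ht (iotaP_comp_app_heq r p y)
    change ((𝔖.deltaShadow θ).she e).map ((𝔖.iotaP θ (r.comp p)).app y) ≫ (𝔖.iotaE e).app _ ≍
      ((𝔖.deltaShadow θ).she e).map (((𝔖.deltaShadow θ).shP p).map ((𝔖.iotaP θ r).app y)) ≫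
        ((𝔖.deltaShadow θ).she e).map ((𝔖.iotaP θ p).app _) ≫ (𝔖.iotaE e).app _
    rw [← Functor.map_comp_assoc]
    exact heq_comp (congrArg _ hs) (congrArg _ ht) (congrArg _ ht) key (app_heq _ ht)

/-- Composition law for the `ι_×`-cells, with the object identifications as `eqToHom`s.
[cite: MochizukiAbsTopIII2015, Cor 3.7 (iii) p.88] -/
theorem iotaP_comp_app {c a b : Cor37Vertex} (r : StarPath.{u} c a) (p : StarPath.{u} a b)
    (y : (𝔖.deltaShadow θ).Sh c) :
    (𝔖.iotaP θ (r.comp p)).app y =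
      eqToHom ((𝔖.deltaShadow θ).shP_comp_obj r p y) ≫
        (((𝔖.deltaShadow θ).shP p).map ((𝔖.iotaP θ r).app y) ≫
          (𝔖.iotaP θ p).app (((𝔖.deltaShadow θ).shP (starFlip r)).obj y)) ≫
        eqToHom (by rw [starFlip_comp, (𝔖.deltaShadow θ).shP_comp_obj]) :=
  (conj_eqToHom_iff_heq' _ _ _ _).mpr (𝔖.iotaP_comp_app_heq θ r p y)

end BiAnabelianSetting

end AbsTopIII

end Literature.AnabelianGeometry.AbsoluteAnabelian
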